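import Mathlib
import Literature.RingTheory.GradedAlgebra.AffineHilbertFunction
import Literature.AlgebraicGeometry.Tropical.InitialIdeal
import Literature.AlgebraicGeometry.Tropical.TropicalLink
import Summits.ResolutionOfSingularities.ResolutionOfSingularities.Theorems.TropicalLinksInductiveStepRayDegenerationGen

/-!
# TropicalLinks / SchonResolves — tropical initial ideals through homogenisation (F3c)

Route `ResolutionOfSingularities/TropicalLinks`, crux `SchonResolves`
(stmt-ResolutionOfSingularities-17234), line `zariski-toric-closure`, stub F3c
(Maclagan–Sturmfels, *Introduction to Tropical Geometry*, Prop. 2.6.1): for a Laurent ideal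
`J ⊆ k[y₁^±, …, yₙ^±] = k[ℤⁿ]` and an integer weight `w ∈ ℤⁿ`, the tropical (MIN-convention)
initial ideal `in_w(J)` (`Tropical.weightInitialIdeal w J`) is obtained from the standard
homogenisation `Ih ⊆ k[x₀, …, xₙ]` of `J ∩ k[y₁, …, yₙ]` (the transport ideal of
`Literature.RingTheory.GradedAlgebra.transportIdeal` for `v = (1, X₁, …, Xₙ)`) by taking the
MAX-convention initial ideal `⟨in^{hw} p : p ∈ Ih⟩` for the nonnegative weight
`hw = (C, C - w₁, …, C - wₙ)`, `C ≫ 0` (top `hw`-weighted homogeneous components), and then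
dehomogenising (`x₀ ↦ 1`) and passing to the Laurent ring (`xᵢ ↦ yᵢ`).

Key computation (`schonResolves_map_topComponent_eq_initialForm`): for a FORM `p` of degree `d`,
a term `x₀^{a₀} x^{a'}` has `hw`-weight `C d - ⟨w, a'⟩`, so the top `hw`-component of `p`
consists of the terms of minimal `⟨w, a'⟩`, and dehomogenisation is injective on forms of a fixed
degree; hence `Λ (in^{hw} p) = in_w (Λ p)`. The inclusion `⊆` reduces to forms since `Ih` is
homogeneous; `⊇` clears denominators (`y^m f ∈ k[y]`), homogenises, and uses that monomials are
units of the Laurent ring. No new definitions.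
-/

-- single-problem summit: the doubled namespace component `ResolutionOfSingularities` is forced
set_option linter.dupNamespace false

namespace Summit.ResolutionOfSingularities.ResolutionOfSingularities.Theorems

open MvPolynomial AddMonoidAlgebra Literature.AlgebraicGeometry.Tropical
  Literature.RingTheory.GradedAlgebra

section Dehomogenize

variable {k : Type} [Field k] {n : ℕ}

/-- Two exponents of `k[x₀, …, xₙ]` of the same total degree with the same `x₁, …, xₙ`-part are
equal. [folklore] -/
theorem schonResolves_finsupp_eq_of_degree_eq {a b : Fin (n + 1) →₀ ℕ} (hd : a.degree = b.degree)
    (ht : ∀ l : Fin n, a (Fin.succ l) = b (Fin.succ l)) : a = b := by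
  have h0 : a 0 = b 0 := by
    rw [Finsupp.degree_eq_sum, Finsupp.degree_eq_sum, Fin.sum_univ_succ, Fin.sum_univ_succ,
      Fintype.sum_congr _ _ ht] at hd
    omega
  ext i
  exact Fin.cases h0 ht i

/-- The weight identity `hw(a) + ⟨w, a'⟩ = C · deg a` for `hw = (C, C - w₁, …, C - wₙ)`,
`C ≥ wₗ`. [folklore] -/
theorem schonResolves_weight_add_dotWeight_eq (w : Fin n → ℤ) (C : ℕ) (hC : ∀ l, w l ≤ C)
    (a : Fin (n + 1) →₀ ℕ) :
    ((Finsupp.weight (Fin.cases C (fun l => ((C : ℤ) - w l).toNat) : Fin (n + 1) → ℕ) a : ℕ) : ℤ)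
      + dotWeight w (fun l => ((a (Fin.succ l) : ℕ) : ℤ)) = C * (a.degree : ℤ) := by
  rw [Finsupp.weight_apply, Finsupp.sum_fintype, Fin.sum_univ_succ, Finsupp.degree_eq_sum,
    Fin.sum_univ_succ, Fin.cases_zero]
  · simp only [Fin.cases_succ, smul_eq_mul, dotWeight]
    have h : ∀ l : Fin n, ((((C : ℤ) - w l).toNat : ℕ) : ℤ) = C - w l := fun l =>
      Int.toNat_of_nonneg (by linarith [hC l])
    push_cast
    simp only [h]
    rw [mul_add, Finset.mul_sum, add_assoc, ← Finset.sum_add_distrib]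
    congr 1
    · ring
    · exact Finset.sum_congr rfl fun l _ => by ring
  · exact fun i => zero_smul ℕ _

/-- **Dehomogenisation as a map of exponents**: the substitution `x₀ ↦ 1`, `xᵢ ↦ yᵢ` from
`k[x₀, …, xₙ]` to the Laurent ring `k[ℤⁿ]` sends `c x^a` to `c y^{a'}`, `a' = (a₁, …, aₙ)`.
[folklore] -/
theorem schonResolves_dehomogenize_eq_mapDomain (x : MvPolynomial (Fin (n + 1)) k) :
    (MvPolynomial.aeval (Fin.cases (1 : AddMonoidAlgebra k (Fin n → ℤ))
        (fun i : Fin n => AddMonoidAlgebra.single (Pi.single i (1 : ℤ)) (1 : k))) :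
        MvPolynomial (Fin (n + 1)) k →ₐ[k] AddMonoidAlgebra k (Fin n → ℤ)) x =
      AddMonoidAlgebra.mapDomain
        (fun (a : Fin (n + 1) →₀ ℕ) (l : Fin n) => ((a (Fin.succ l) : ℕ) : ℤ)) x := by
  classical
  induction x using MvPolynomial.induction_on' with
  | monomial a c =>
    rw [aeval_monomial, Finsupp.prod_fintype _ _ (fun i => pow_zero _), Fin.prod_univ_succ]
    simp only [Fin.cases_zero, Fin.cases_succ, one_pow, one_mul, single_pow, prod_single,
      Finset.prod_const_one]
    rw [← single_eq_monomial, mapDomain_single, Algebra.algebraMap_eq_smul_one, smul_mul_assoc,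
      one_mul, smul_single', mul_one]
    congr 1
    funext j
    simp [Finset.sum_apply, Pi.single_apply]
  | add p q hp hq => rw [map_add, mapDomain_add, hp, hq]

/-- **Key computation** (abstract form). If `Λ` acts on exponents through `τ`, `τ` is injective
on exponents of a fixed degree, and the `ℕ`-weight `hw` satisfies `hw(a) + ⟨w, τ a⟩ = C · deg a`,
then for every FORM `p` the image of its top `hw`-component is the min-convention initial form
of its image: `Λ (in^{hw} p) = in_w (Λ p)`. [cite: MaclaganSturmfels2015, Prop. 2.6.1] -/
theorem schonResolves_map_topComponent_eq_initialForm {w : Fin n → ℤ} {hw : Fin (n + 1) → ℕ}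
    {C : ℤ} {τ : (Fin (n + 1) →₀ ℕ) → (Fin n → ℤ)}
    (hhw : ∀ a, ((Finsupp.weight hw a : ℕ) : ℤ) + dotWeight w (τ a) = C * (a.degree : ℤ))
    (hτ : ∀ a b, a.degree = b.degree → τ a = τ b → a = b)
    {Λ : MvPolynomial (Fin (n + 1)) k →ₐ[k] AddMonoidAlgebra k (Fin n → ℤ)}
    (hΛ : ∀ x, Λ x = AddMonoidAlgebra.mapDomain τ x)
    {p : MvPolynomial (Fin (n + 1)) k} {d : ℕ} (hp : p.IsHomogeneous d) :
    Λ (weightedHomogeneousComponent hw (weightedTotalDegree hw p) p) =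
      initialForm (dotWeight w) (Λ p) := by
  classical
  have hdeg : ∀ a ∈ p.support, a.degree = d := fun a ha => by
    rw [Finsupp.degree_eq_weight_one]; exact hp (mem_support_iff.mp ha)
  have hinj : Set.InjOn τ (p.support : Set (Fin (n + 1) →₀ ℕ)) := fun a ha b hb h =>
    hτ a b ((hdeg a ha).trans (hdeg b hb).symm) h
  have hcmp : ∀ a ∈ p.support, ∀ b ∈ p.support,
      (Finsupp.weight hw b ≤ Finsupp.weight hw a ↔ dotWeight w (τ a) ≤ dotWeight w (τ b)) := by
    intro a ha b hb
    have h1 := hhw a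
    have h2 := hhw b
    rw [hdeg a ha] at h1
    rw [hdeg b hb] at h2
    constructor
    · intro h
      have h' : ((Finsupp.weight hw b : ℕ) : ℤ) ≤ Finsupp.weight hw a := by exact_mod_cast h
      linarith
    · intro h
      have h' : ((Finsupp.weight hw b : ℕ) : ℤ) ≤ Finsupp.weight hw a := by linarith
      exact_mod_cast h'
  have hsub : ((AddMonoidAlgebra.coeff
      (weightedHomogeneousComponent hw (weightedTotalDegree hw p) p)).support :
        Set (Fin (n + 1) →₀ ℕ)) ⊆ p.support := by
    intro a ha
    rw [Finset.mem_coe, Finsupp.mem_support_iff] at ha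
    change MvPolynomial.coeff a _ ≠ 0 at ha
    rw [coeff_weightedHomogeneousComponent] at ha
    by_cases h : Finsupp.weight hw a = weightedTotalDegree hw p
    · rw [if_pos h] at ha
      exact mem_support_iff.mpr ha
    · rw [if_neg h] at ha
      exact absurd rfl ha
  rw [hΛ, hΛ p]
  apply AddMonoidAlgebra.coeff_injective
  ext v
  rw [coeff_initialForm_apply, coeff_mapDomain, coeff_mapDomain]
  by_cases hv : v ∈ p.support.image τ
  · obtain ⟨a, ha, rfl⟩ := Finset.mem_image.1 hv
    rw [Finsupp.mapDomain_apply' _ _ hsub hinj (Finset.mem_coe.2 ha),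
      Finsupp.mapDomain_apply' _ _ subset_rfl hinj (Finset.mem_coe.2 ha)]
    change MvPolynomial.coeff a (weightedHomogeneousComponent hw _ p) =
      if _ then MvPolynomial.coeff a p else 0
    rw [coeff_weightedHomogeneousComponent]
    have hiff : Finsupp.weight hw a = weightedTotalDegree hw p ↔
        ∀ u ∈ (Finsupp.mapDomain τ (AddMonoidAlgebra.coeff p)).support,
          dotWeight w (τ a) ≤ dotWeight w u := by
      rw [Finsupp.mapDomain_support_of_injOn _ hinj]
      constructor
      · intro h u hu
        obtain ⟨b, hb, rfl⟩ := Finset.mem_image.1 hu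
        rw [← hcmp a ha b hb, h]
        exact le_weightedTotalDegree hw hb
      · intro h
        refine le_antisymm (le_weightedTotalDegree hw ha) (Finset.sup_le fun b hb => ?_)
        exact (hcmp a ha b hb).2 (h (τ b) (Finset.mem_image_of_mem τ hb))
    by_cases h : Finsupp.weight hw a = weightedTotalDegree hw p
    · rw [if_pos h, if_pos (hiff.1 h)]
    · rw [if_neg h, if_neg (mt hiff.2 h)]
  · have hv' : v ∉ τ '' (p.support : Set (Fin (n + 1) →₀ ℕ)) := by
      rwa [← Finset.coe_image, Finset.mem_coe]
    have hv'' : v ∉ τ '' ((AddMonoidAlgebra.coeff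
        (weightedHomogeneousComponent hw (weightedTotalDegree hw p) p)).support :
          Set (Fin (n + 1) →₀ ℕ)) := fun h => hv' (Set.image_mono hsub h)
    rw [Finsupp.mapDomain_of_not_mem_image_support hv'',
      Finsupp.mapDomain_of_not_mem_image_support hv', ite_self]

/-- **Clearing denominators**: every Laurent polynomial `f ∈ k[ℤⁿ]` becomes, after
multiplication by a monomial `y^m`, the image of a polynomial of `k[ℕⁿ]`. [folklore] -/
theorem schonResolves_exists_mapDomain_eq_single_mul (ι : (Fin n →₀ ℕ) → (Fin n → ℤ))
    (hι : ∀ b l, ι b l = ((b l : ℕ) : ℤ)) (f : AddMonoidAlgebra k (Fin n → ℤ)) :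
    ∃ (m : Fin n → ℤ) (q : AddMonoidAlgebra k (Fin n →₀ ℕ)),
      AddMonoidAlgebra.mapDomain ι q = single m (1 : k) * f := by
  classical
  have hinj : Function.Injective ι := fun b b' h => Finsupp.ext fun l => by
    have := congr_fun h l
    rw [hι, hι] at this
    exact_mod_cast this
  refine ⟨fun l => ((f.coeff.support.sup fun v => (-v l).toNat : ℕ) : ℤ),
    comapDomain ι hinj _, mapDomain_comapDomain (fun u hu => ?_) hinj⟩
  rw [Finset.mem_coe, Finsupp.mem_support_iff, coeff_single_mul_apply, one_mul] at hu
  have hu' := Finsupp.mem_support_iff.2 hu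
  refine ⟨Finsupp.equivFunOnFinite.symm (fun l => (u l).toNat), funext fun l => ?_⟩
  rw [hι, Finsupp.coe_equivFunOnFinite_symm]
  have h1 : (-(-(fun l => ((f.coeff.support.sup fun v => (-v l).toNat : ℕ) : ℤ)) + u) l).toNat ≤
      f.coeff.support.sup fun v => (-v l).toNat :=
    Finset.le_sup (f := fun v : Fin n → ℤ => (-v l).toNat) hu'
  simp only [Pi.add_apply, Pi.neg_apply] at h1
  have h2 := Int.self_le_toNat
    (-(-((f.coeff.support.sup fun v => (-v l).toNat : ℕ) : ℤ) + u l))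
  exact Int.toNat_of_nonneg (by omega)

/-- **Homogenisation**: every `q ∈ k[X₁, …, Xₙ]` is the dehomogenisation `p(1, X₁, …, Xₙ)` of a
form `p ∈ k[x₀, …, xₙ]` (of degree `deg q`). [folklore] -/
theorem schonResolves_exists_isHomogeneous_aeval_eq (q : MvPolynomial (Fin n) k) :
    ∃ (p : MvPolynomial (Fin (n + 1)) k) (D : ℕ), p.IsHomogeneous D ∧
      MvPolynomial.aeval (Fin.cases (1 : MvPolynomial (Fin n) k) (fun i => MvPolynomial.X i) :
        Fin (n + 1) → MvPolynomial (Fin n) k) p = q := by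
  refine ⟨∑ d ∈ Finset.range (q.totalDegree + 1),
    X 0 ^ (q.totalDegree - d) * rename Fin.succ (homogeneousComponent d q), q.totalDegree, ?_, ?_⟩
  · refine IsHomogeneous.sum _ _ _ fun d hd => ?_
    have h : (X 0 ^ (q.totalDegree - d) * rename Fin.succ (homogeneousComponent d q) :
        MvPolynomial (Fin (n + 1)) k).IsHomogeneous (q.totalDegree - d + d) :=
      (isHomogeneous_X_pow _ _).mul (homogeneousComponent_isHomogeneous d q).rename_isHomogeneous
    rwa [Nat.sub_add_cancel (by have := Finset.mem_range.1 hd; omega)] at h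
  · simp only [map_sum, map_mul, map_pow, aeval_X, Fin.cases_zero, one_pow, one_mul, aeval_rename]
    have : ((Fin.cases (1 : MvPolynomial (Fin n) k) (fun i => MvPolynomial.X i) :
        Fin (n + 1) → MvPolynomial (Fin n) k) ∘ Fin.succ) = X := funext fun l => Fin.cases_succ _
    rw [this, aeval_X_left]
    exact sum_homogeneousComponent q

/-- **F3c — Maclagan–Sturmfels, Prop. 2.6.1: the tropical initial ideal of a Laurent ideal
through its homogenisation.** For a field `k`, a Laurent ideal `J ⊆ k[ℤⁿ]` and a weight
`w ∈ ℤⁿ`, let `Jpoly = J ∩ k[ℕⁿ]` (moved to `MvPolynomial (Fin n) k`), `Ih ⊆ k[x₀, …, xₙ]` its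
homogenisation (the transport ideal for `v = (1, X₁, …, Xₙ)`), `hw = (C, C - w₁, …, C - wₙ)` with
`C = max wₗ⁺`, and `I₁ = ⟨in^{hw} p : p ∈ Ih⟩` (top `hw`-components, max-convention). Then the
image of `I₁` under `x₀ ↦ 1, xᵢ ↦ yᵢ` generates the min-convention initial ideal `in_w(J)`:
`Ideal.map Λ I₁ = weightInitialIdeal w J`. [cite: MaclaganSturmfels2015, Prop. 2.6.1] -/
theorem schonResolves_map_dehomogenize_inIdeal_transportIdeal_eq_weightInitialIdeal : ∀ (k : Type) [Field k] (n : ℕ) (J : Ideal (AddMonoidAlgebra k (Fin n → ℤ))) (w : Fin n → ℤ), Ideal.map (MvPolynomial.aeval (Fin.cases (1 : AddMonoidAlgebra k (Fin n → ℤ)) (fun i : Fin n => AddMonoidAlgebra.single (Pi.single i (1 : ℤ)) (1 : k))) : MvPolynomial (Fin (n + 1)) k →ₐ[k] AddMonoidAlgebra k (Fin n → ℤ)) (Ideal.span ((fun f : MvPolynomial (Fin (n + 1)) k => MvPolynomial.weightedHomogeneousComponent (Fin.cases (Finset.univ.sup fun l : Fin n => (w l).toNat) (fun l : Fin n => ((Finset.univ.sup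 fun l : Fin n => (w l).toNat : ℕ) - w l).toNat) : Fin (n + 1) → ℕ) (MvPolynomial.weightedTotalDegree (Fin.cases (Finset.univ.sup fun l : Fin n => (w l).toNat) (fun l : Fin n => ((Finset.univ.sup fun l : Fin n => (w l).toNat : ℕ) - w l).toNat) : Fin (n + 1) → ℕ) f) f) '' (↑(Literature.RingTheory.GradedAlgebra.transportIdeal (K := k) (Fin.cases (1 : MvPolynomial (Fin n) k) (fun i => MvPolynomial.X i) : Fin (n + 1) → MvPolynomial (Fin n) k) (((Literature.AlgebraicGeometry.Tropical.linkIdeal (AddMonoidHom.compLeft (Nat.castAddMonoidHom ℤ) (Fin n)) J).map (AddMonoidAlgebra.domCongr k k (Finsupp.addEquivFunOnFinite (ι := Fin n) (M := ℕ)).symm)) : Ideal (MvPolynomial (Fin n) k))) : Set (MvPolynomial (Fin (n + 1)) k)))) = Literature.AlgebraicGeometry.Tropical.weightInitialIdeal w J := by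
  intro k _ n J w
  classical
  set C : ℕ := Finset.univ.sup fun l : Fin n => (w l).toNat with hCdef
  set hw : Fin (n + 1) → ℕ := Fin.cases C (fun l : Fin n => ((C : ℤ) - w l).toNat) with hhwdef
  set Λ : MvPolynomial (Fin (n + 1)) k →ₐ[k] AddMonoidAlgebra k (Fin n → ℤ) :=
    MvPolynomial.aeval (Fin.cases (1 : AddMonoidAlgebra k (Fin n → ℤ))
      (fun i : Fin n => AddMonoidAlgebra.single (Pi.single i (1 : ℤ)) (1 : k))) with hΛdef
  set v : Fin (n + 1) → MvPolynomial (Fin n) k :=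
    Fin.cases (1 : MvPolynomial (Fin n) k) (fun i => MvPolynomial.X i) with hvdef
  set e := Finsupp.addEquivFunOnFinite (ι := Fin n) (M := ℕ) with hedef
  set castN := AddMonoidHom.compLeft (Nat.castAddMonoidHom ℤ) (Fin n) with hcastNdef
  set Jpoly : Ideal (MvPolynomial (Fin n) k) :=
    (linkIdeal castN J).map (AddMonoidAlgebra.domCongr k k e.symm) with hJpolydef
  set Ih : Ideal (MvPolynomial (Fin (n + 1)) k) := transportIdeal (K := k) v Jpoly with hIhdef
  -- the weight identity, injectivity of dehomogenisation on forms, `Λ` on exponents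
  have hC : ∀ l, w l ≤ (C : ℤ) := fun l => (Int.self_le_toNat _).trans
    (by exact_mod_cast Finset.le_sup (f := fun l : Fin n => (w l).toNat) (Finset.mem_univ l))
  have hhw := schonResolves_weight_add_dotWeight_eq w C hC
  have hτ : ∀ a b : Fin (n + 1) →₀ ℕ, a.degree = b.degree →
      (fun l : Fin n => ((a (Fin.succ l) : ℕ) : ℤ)) = (fun l => ((b (Fin.succ l) : ℕ) : ℤ)) →
        a = b :=
    fun a b hd h => schonResolves_finsupp_eq_of_degree_eq hd fun l => by
      have := congr_fun h l
      simp only [Nat.cast_inj] at this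
      exact this
  have hΛ : ∀ x, Λ x = AddMonoidAlgebra.mapDomain
      (fun (a : Fin (n + 1) →₀ ℕ) (l : Fin n) => ((a (Fin.succ l) : ℕ) : ℤ)) x :=
    schonResolves_dehomogenize_eq_mapDomain
  -- the Laurent embedding `k[ℕⁿ] → k[ℤⁿ]` and its relation to `Jpoly` and `Λ`
  obtain ⟨castι, hcastι⟩ : ∃ castι : (Fin n →₀ ℕ) →+ (Fin n → ℤ),
      castι = castN.comp (e : (Fin n →₀ ℕ) →+ (Fin n → ℕ)) := ⟨_, rfl⟩
  have hι : ∀ b l, castι b l = ((b l : ℕ) : ℤ) := fun b l => by rw [hcastι]; rfl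
  have hE : ∀ r : MvPolynomial (Fin n) k,
      r ∈ Jpoly ↔ AddMonoidAlgebra.mapDomain castι r ∈ J := by
    intro r
    rw [hJpolydef, mem_map_domCongr_iff, domCongr_symm, AddEquiv.symm_symm, mem_linkIdeal_iff]
    have : AddMonoidAlgebra.mapDomain castN (AddMonoidAlgebra.domCongr k k e r) =
        AddMonoidAlgebra.mapDomain castι r := by
      apply AddMonoidAlgebra.coeff_injective
      rw [show AddMonoidAlgebra.domCongr k k e r = (AddMonoidAlgebra.domCongr k k e).toAlgHom r
          from rfl, domCongr_toAlgHom, mapDomainAlgHom_apply, coeff_mapDomain, coeff_mapDomain,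
        coeff_mapDomain, ← Finsupp.mapDomain_comp, hcastι]
      rfl
    rw [this]
  have hG : ∀ p, Λ p = AddMonoidAlgebra.mapDomain castι (MvPolynomial.aeval v p) := by
    have hG' : Λ = (mapDomainAlgHom k k castι).comp (MvPolynomial.aeval v) := by
      refine MvPolynomial.algHom_ext fun i => ?_
      refine Fin.cases ?_ (fun l => ?_) i
      · rw [hΛdef, AlgHom.comp_apply, aeval_X, aeval_X, hvdef]
        simp only [Fin.cases_zero, map_one]
      · rw [hΛdef, AlgHom.comp_apply, aeval_X, aeval_X, hvdef]
        simp only [Fin.cases_succ, mapDomainAlgHom_apply]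
        rw [X, ← single_eq_monomial, mapDomain_single]
        congr 1
        funext j
        rw [hι, Finsupp.single_apply, Pi.single_apply]
        by_cases h : j = l
        · subst h
          simp
        · rw [if_neg (Ne.symm h), if_neg h, Nat.cast_zero]
    intro p
    rw [hG']
    rfl
  apply le_antisymm
  · -- `⊆`: reduce to forms, for which `Λ (in^{hw} q) = in_w (Λ q)` with `Λ q ∈ J`
    rw [Ideal.map_le_iff_le_comap, Ideal.span_le]
    rintro _ ⟨p, hp, rfl⟩
    have hp' : p ∈ Ih := hp
    rw [SetLike.mem_coe, Ideal.mem_comap]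
    have hcomp : ∀ i, Λ (weightedHomogeneousComponent hw (weightedTotalDegree hw p)
        (homogeneousComponent i p)) ∈ weightInitialIdeal w J := by
      intro i
      have hqJ : Λ (homogeneousComponent i p) ∈ J := by
        rw [hG, ← hE]
        exact (mem_transportIdeal_iff (𝔟 := Jpoly) v).1 hp' i
      by_cases hi : weightedTotalDegree hw (homogeneousComponent i p) = weightedTotalDegree hw p
      · rw [← hi, schonResolves_map_topComponent_eq_initialForm hhw hτ hΛ
          (homogeneousComponent_isHomogeneous i p)]
        exact initialForm_mem_initialIdeal _ hqJ
      · have hle : weightedTotalDegree hw (homogeneousComponent i p) ≤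
            weightedTotalDegree hw p :=
          Finset.sup_mono (by rw [support_homogeneousComponent]; exact Finset.filter_subset _ _)
        rw [weightedHomogeneousComponent_eq_zero _ _ (lt_of_le_of_ne hle hi), map_zero]
        exact Ideal.zero_mem _
    have hsum : Λ (weightedHomogeneousComponent hw (weightedTotalDegree hw p) p) =
        ∑ i ∈ Finset.range (p.totalDegree + 1), Λ (weightedHomogeneousComponent hw
          (weightedTotalDegree hw p) (homogeneousComponent i p)) := by
      rw [← map_sum, ← map_sum, sum_homogeneousComponent]
    rw [hsum]
    exact Ideal.sum_mem _ fun i _ => hcomp i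
  · -- `⊇`: clear denominators, homogenise, and divide by the monomial unit
    show initialIdeal (dotWeight w) J ≤ _
    unfold initialIdeal
    rw [Ideal.span_le]
    rintro _ ⟨f, hf, rfl⟩
    obtain ⟨m, q, hq⟩ := schonResolves_exists_mapDomain_eq_single_mul castι hι f
    obtain ⟨ph, D, hph, hphq⟩ := schonResolves_exists_isHomogeneous_aeval_eq (k := k) q
    have hphI : ph ∈ Ih := by
      rw [hIhdef, mem_transportIdeal_iff_of_isHomogeneous v hph, hE, hphq, hq]
      exact J.mul_mem_left _ hf
    have h1 : Λ (weightedHomogeneousComponent hw (weightedTotalDegree hw ph) ph) ∈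
        Ideal.map Λ (Ideal.span ((fun f => weightedHomogeneousComponent hw
          (weightedTotalDegree hw f) f) '' (Ih : Set (MvPolynomial (Fin (n + 1)) k)))) :=
      Ideal.mem_map_of_mem Λ (Ideal.subset_span ⟨ph, hphI, rfl⟩)
    have h2 := tropicalLinks_initialForm_single_one_mul (k := k) (dotWeightHom w) m f
    rw [coe_dotWeightHom] at h2
    rw [schonResolves_map_topComponent_eq_initialForm hhw hτ hΛ hph, hG, hphq, hq, h2] at h1
    exact (Ideal.unit_mul_mem_iff_mem _ (isUnit_single isUnit_one m)).1 h1

end Dehomogenize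

end Summit.ResolutionOfSingularities.ResolutionOfSingularities.Theorems
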